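import Summits.MatrixMultiplication.MatrixMultiplication.Theorems.ObstructionCalculusAction
import Summits.MatrixMultiplication.MatrixMultiplication.Theses.ObstructionDescent

/-!
# Rung R2 of the degree axis, modulo the named cactus barrier: linear rank methods are blind on `GL_m³·pad_m⟨n,n,n⟩`
(decomp-mm · lens 3 · gen 18, third kernel)

Route `route-MatrixMultiplication-ObstructionDescent` (`ω(ℂ) = 2`), aside item 30921 `RankMethodsBlindPastCactus`
(rung R2 of `E = NoPolyDegreeObstruction`: the DETERMINANTAL class of equations of `σ_m`, every degree).
`rankMethodsBlindPastCactus_of`: the item follows from the tree's NAMED FACT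
`Literature.Barriers.MatrixMultiplication.Buczynski2026_cactusBarrier_segre` (Buczyński's cactus barrier for
three-factor Segre formats; taken here as the hypothesis `hcb`, spelled out VERBATIM — the statement module
`LinearRankMethodBarrier` is unbuilt on the farm snapshot at check time, so it is not imported; `hcb` is its body, and
the named fact / its proof instantiate it by `rfl`) — restrict the linear rank method `L : ℂ^{m³} → Mat_{p×q}` along the corner action
`t ↦ (A,B,C)·pad_m(t)` (again linear, again `rk ≤ k` on rank-one tensors, now on `(ℂ^{n²})^{⊗3}` where the cactus
variety `𝔎_{6n²−4}` fills), so `rk L((A,B,C)·pad_m⟨n,n,n⟩) ≤ k(6n² − 4) ≤ k·m` past the wall `m ≥ 6n² − 4`,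
for ALL `A, B, C ∈ Mat_m` — the maximum `L` takes on `σ_m`.  The named fact is PROVED in the tree
(`Buczynski2026_cactusBarrier_segre_holds`, `LinearRankMethodBarrierProofs.lean`); the closing term of item 30921
is `rankMethodsBlindPastCactus_of Buczynski2026_cactusBarrier_segre_holds` in a file importing that module
(its dependency `Literature.Computability.AlgebraicComplexity.HankelRank` is unbuilt on the farm snapshot at check
time, rc 75 since gen 15 — hence the conditional form now).  No proposition is defined; sorry-free; standard axioms.
[cite: Buczynski2026, Thm. 2 / Cor. 13 / §1.3; LandsbergGCT2017, §10.2.2 (p. 289); BurgisserIkenmeyer2011, §2 and §5]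
-/

set_option linter.dupNamespace false
set_option autoImplicit false

noncomputable section

open scoped BigOperators

namespace Summit.MatrixMultiplication.MatrixMultiplication.Theorems.ObstructionDescentRankMethodsBlind

open Literature.Computability.AlgebraicComplexity (actTensor matMulTensor triad actTensor_triad actTensor_zero)
open Summit.MatrixMultiplication.MatrixMultiplication.Theorems.ObstructionCalculus (Tensor padTensor padVec
  padIdx padMM padTensor_triad actTensor_add')
open Summit.MatrixMultiplication.MatrixMultiplication.Theses.ObstructionDescent (RankMethodsBlindPastCactus)

/-! ## §1 The corner action is linear -/

/-- Zero-padding is additive. [bookkeeping] -/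
theorem padTensor_add {m : ℕ} {ι : Type} [Fintype ι] (e : ι → Fin m) (s t : ι → ι → ι → ℂ) :
    padTensor e (s + t) = padTensor e s + padTensor e t := by
  funext a b c
  simp only [padTensor, Pi.add_apply, mul_add, Finset.sum_add_distrib]

/-- Zero-padding commutes with scalars. [bookkeeping] -/
theorem padTensor_smul {m : ℕ} {ι : Type} [Fintype ι] (e : ι → Fin m) (z : ℂ) (t : ι → ι → ι → ℂ) :
    padTensor e (z • t) = z • padTensor e t := by
  funext a b c
  simp only [padTensor, Pi.smul_apply, smul_eq_mul, Finset.mul_sum]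
  exact Finset.sum_congr rfl fun p _ => by ring

/-- The action `(A,B,C)·t` commutes with scalars. [folklore] -/
theorem actTensor_smul' {m : ℕ} (A B C : Matrix (Fin m) (Fin m) ℂ) (z : ℂ) (t : Tensor ℂ m) :
    actTensor A B C (z • t) = z • actTensor A B C t := by
  funext a b c
  simp only [Literature.Computability.AlgebraicComplexity.actTensor_apply, Pi.smul_apply, smul_eq_mul,
    Finset.mul_sum]
  exact Finset.sum_congr rfl fun a' _ => Finset.sum_congr rfl fun b' _ =>
    Finset.sum_congr rfl fun c' _ => by ring

/-! ## §2 The cactus bound on the pad, and rung R2 -/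

/-- **The cactus bound on `GL_m³·pad_m⟨n,n,n⟩`** (modulo the named fact): a linear rank method on `ℂ^{m³}`
with `rk ≤ k` on rank-one tensors has `rk L((A,B,C)·pad_m⟨n,n,n⟩) ≤ k·(6n² − 4)` for ALL `A, B, C ∈ Mat_m`
(`n ≥ 1`): `L ∘ [t ↦ (A,B,C)·pad_m t]` is a linear rank method on `(ℂ^{n²})^{⊗3}` with the same `k`
(triads go to triads), and there the cactus barrier bounds it on every tensor, in particular on `⟨n,n,n⟩`.
[cite: Buczynski2026, Thm. 2 / Cor. 13; LandsbergGCT2017, §10.2.2 (p. 289)] -/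
theorem rank_apply_actTensor_padMM_le (hcb : ∀ {ι κ μ : Type} [Fintype ι] [Fintype κ] [Fintype μ] (a b c : ℕ), 1 ≤ a → 1 ≤ b → 1 ≤ c →
      Fintype.card ι = a → Fintype.card κ = b → Fintype.card μ = c →
        ∀ (p q : ℕ) (L : (ι → κ → μ → ℂ) →ₗ[ℂ] Matrix (Fin p) (Fin q) ℂ) (k : ℕ),
          (∀ (w : ι → ℂ) (u : κ → ℂ) (v : μ → ℂ), (L (triad w u v)).rank ≤ k) →
            ∀ t : ι → κ → μ → ℂ, (L t).rank ≤ k * (2 * (a + b + c - 2))) {n m : ℕ} (hn : 1 ≤ n)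
    (h : n * n ≤ m) {p q k : ℕ} (L : Tensor ℂ m →ₗ[ℂ] Matrix (Fin p) (Fin q) ℂ)
    (hk : ∀ w u v : Fin m → ℂ, (L (triad w u v)).rank ≤ k) (A B C : Matrix (Fin m) (Fin m) ℂ) :
    (L (actTensor A B C (padMM ℂ n m h))).rank ≤ k * (6 * n ^ 2 - 4) := by
  let Φ : (Fin n × Fin n → Fin n × Fin n → Fin n × Fin n → ℂ) →ₗ[ℂ] Tensor ℂ m :=
    { toFun := fun t => actTensor A B C (padTensor (padIdx n m h) t)
      map_add' := fun s t => by simp only [padTensor_add, actTensor_add']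
      map_smul' := fun z t => by simp only [padTensor_smul, actTensor_smul', RingHom.id_apply] }
  have hk' : ∀ w u v : Fin n × Fin n → ℂ, ((L ∘ₗ Φ) (triad w u v)).rank ≤ k := by
    intro w u v
    show (L (actTensor A B C (padTensor (padIdx n m h) (triad w u v)))).rank ≤ k
    rw [padTensor_triad, actTensor_triad]
    exact hk _ _ _
  have hcard : Fintype.card (Fin n × Fin n) = n ^ 2 := by simp [Fintype.card_prod, sq]
  have h1 : 1 ≤ n ^ 2 := Nat.one_le_pow _ _ hn
  have key := hcb (n ^ 2) (n ^ 2) (n ^ 2) h1 h1 h1 hcard hcard hcard p q (L ∘ₗ Φ) k hk' (matMulTensor ℂ n n n)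
  have e : 2 * (n ^ 2 + n ^ 2 + n ^ 2 - 2) = 6 * n ^ 2 - 4 := by omega
  rw [e] at key
  exact key

/-- For `n = 0` the pad is the zero tensor. [bookkeeping] -/
theorem padMM_zero {m : ℕ} (h : 0 * 0 ≤ m) : padMM ℂ 0 m h = 0 := by
  funext a b c
  simp [padMM, padTensor]

/-- **Rung R2 (item 30921) modulo the named cactus barrier**: `Buczynski2026_cactusBarrier_segre →
RankMethodsBlindPastCactus` — past the wall `m ≥ 6n² − 4`, every linear rank method with `rk ≤ k` on rank-one
tensors has `rk L((A,B,C)·pad_m⟨n,n,n⟩) ≤ k·m` for all `A, B, C ∈ Mat_m`, the maximum it takes on `σ_m`; so no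
`σ_m`-equation of the determinantal class (a `(km+1)`-minor of such an `L`, any degree) separates the `GL_m³`-orbit
of the pad from `σ_m`.  The item closes by `rankMethodsBlindPastCactus_of Buczynski2026_cactusBarrier_segre_holds`.
[cite: Buczynski2026, Thm. 2 / Cor. 13 / §1.3; LandsbergGCT2017, §10.2.2 (p. 289); BurgisserIkenmeyer2011, §5] -/
theorem rankMethodsBlindPastCactus_of (hcb : ∀ {ι κ μ : Type} [Fintype ι] [Fintype κ] [Fintype μ] (a b c : ℕ), 1 ≤ a → 1 ≤ b → 1 ≤ c →
      Fintype.card ι = a → Fintype.card κ = b → Fintype.card μ = c →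
        ∀ (p q : ℕ) (L : (ι → κ → μ → ℂ) →ₗ[ℂ] Matrix (Fin p) (Fin q) ℂ) (k : ℕ),
          (∀ (w : ι → ℂ) (u : κ → ℂ) (v : μ → ℂ), (L (triad w u v)).rank ≤ k) →
            ∀ t : ι → κ → μ → ℂ, (L t).rank ≤ k * (2 * (a + b + c - 2))) : RankMethodsBlindPastCactus := by
  intro n m h hm p q k L hk A B C
  change (L (actTensor A B C (padMM ℂ n m h))).rank ≤ k * m
  rcases Nat.eq_zero_or_pos n with rfl | hn
  · rw [padMM_zero, actTensor_zero, map_zero, Matrix.rank_zero]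
    exact Nat.zero_le _
  · exact (rank_apply_actTensor_padMM_le hcb hn h L hk A B C).trans (Nat.mul_le_mul_left k hm)

/-- The same past the coarser wall `m ≥ 6n²` (the form in which the cells of `E` — `m ≥ n^τ`, `τ > 2`, `n` large —
meet rung R2). [bookkeeping] -/
theorem rank_apply_le_of_six_sq_le (hcb : ∀ {ι κ μ : Type} [Fintype ι] [Fintype κ] [Fintype μ] (a b c : ℕ), 1 ≤ a → 1 ≤ b → 1 ≤ c →
      Fintype.card ι = a → Fintype.card κ = b → Fintype.card μ = c →
        ∀ (p q : ℕ) (L : (ι → κ → μ → ℂ) →ₗ[ℂ] Matrix (Fin p) (Fin q) ℂ) (k : ℕ),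
          (∀ (w : ι → ℂ) (u : κ → ℂ) (v : μ → ℂ), (L (triad w u v)).rank ≤ k) →
            ∀ t : ι → κ → μ → ℂ, (L t).rank ≤ k * (2 * (a + b + c - 2))) {n m : ℕ} (h : n * n ≤ m)
    (hm : 6 * n ^ 2 ≤ m) {p q k : ℕ} (L : Tensor ℂ m →ₗ[ℂ] Matrix (Fin p) (Fin q) ℂ)
    (hk : ∀ w u v : Fin m → ℂ, (L (triad w u v)).rank ≤ k) (A B C : Matrix (Fin m) (Fin m) ℂ) :
    (L (actTensor A B C (padMM ℂ n m h))).rank ≤ k * m :=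
  rankMethodsBlindPastCactus_of hcb n m h ((Nat.sub_le _ _).trans hm) p q k L hk A B C

end Summit.MatrixMultiplication.MatrixMultiplication.Theorems.ObstructionDescentRankMethodsBlind

end
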